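import Summits.CriticalPhenomena.CardyFormulaZ2.Theorems.CardyIKTransportIKLinearTransportPinnedDefs

/-!
# Stub `stub_PinnedSampler` (line `pinned-diagram-exchange`, crux stmt-CriticalPhenomena-5076) —
# the SHAPE OF THE REMAINING THEOREM, static form (strong spatial mixing IN MEAN + coding)

Support file (`--supports stmt-CriticalPhenomena-5076`, registered sub-goal
`pinnedSampler_of_meanSSM_of_coding`). After the landed round-1 helpers (uniform levels p94321,
fibrewise resampler p94331, pinned resampler + null-set upgrade p94837, pinned conditional law p95120)
the registered stub

  `stub_PinnedSampler : ∃ C c, 0 < c ∧ ∀ S i, (i ∈ S ↔ i + 1 ∉ S) → ∃ G, PinnedSampler C c S i G`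

owes exactly the ALMOST-SURE vertical covariance and the exponential quasi-locality with constants uniform
in `(S, i)`. This file types the two statements this reduces to, as PARAMETRISED predicates (nothing
closed, nothing cited — they are statements the line POSITS), and proves the sorry-free composition:

* `pinnedStat i` — the pinned statistic `(eraseMid i, stripDiagram i)`;
* `IsPinnedCondLaw S i κ` — `κ` is a regular conditional law of the exchanged model `νmix (S ∆ {i,i+1})`
  given the pinned statistic (non-vacuous: `ps_exists_pinnedCondLaw`, p95120);
* `tvOn W μ ν` — total variation on the events determined by the window `W`;
* (A) `MeanSSM C c S i` — STRONG SPATIAL MIXING IN MEAN of the diagram-conditioned middle data: the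
  conditional law on `ballInf v r`, given the pinned statistic, is within `C e^{-c r}` in total
  variation — ON AVERAGE over the environment `x ∼ νmix S` — of a law reading `x` on `ballInf v (2r)`.
  Worst case is FALSE (two monochromatic boundary corridors decided outside the window, environment
  probability `≈ 4^{-r}`, influence `0.5` at every `r`); in mean the transfer-matrix numerics of the line
  give mean influence `≈ 0.3 e^{-1.5 r}` (65 000 environments, heights 33 and 45);
* (B) the CODING STEP is kept as the second hypothesis of the composition, fully quantified in the theorem
  statement (no closed `Prop`): mean SSM with constants `C, c` and strip diagram exchange give a pinned
  sampler with constants `C', c'` depending on `C, c` only. Its dynamical refinement — coupling from the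
  past along rows for the diagram-conditioned chain — is the subject of the sibling files
  `…StubPinnedSamplerCFTP*.lean`.

`pinnedSampler_of_meanSSM_of_coding` (sorry-free): (A) uniform in `(S, i)` + (B) ⇒ the registered
signature of `stub_PinnedSampler` verbatim (when `StripDiagramExchange S i` fails the identity sampler
qualifies, `pinnedSampler_id_of_not`, so the composition needs no hypothesis on the neighbour stub).
-/

noncomputable section

namespace Summit.CriticalPhenomena.CardyFormulaZ2.Theorems.IKLinearTransport.PinnedDiagramExchange

open scoped Classical MeasureTheory ENNReal symmDiff
open Set MeasureTheory
open Literature.Probability.Percolation Literature.Probability.LatticeModels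

/-- The pinned statistic: (off-middle observables, strip diagram). [folklore] -/
def pinnedStat (i : ℤ) (x : Obs) : Obs × Set (Site 2 × Site 2) := (eraseMid i x, stripDiagram i x)

/-- `κ` is a regular conditional law of the exchanged model `νmix (S ∆ {i,i+1})` given the pinned statistic:
a measurable family of probability measures, constant on the fibres, a.s. carried by the fibres,
disintegrating the model. [folklore] -/
def IsPinnedCondLaw (S : Set ℤ) (i : ℤ) (κ : Obs → Measure Obs) : Prop :=
  (∀ x, IsProbabilityMeasure (κ x)) ∧ Measurable κ ∧
  (∀ x x', pinnedStat i x = pinnedStat i x' → κ x = κ x') ∧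
  (∀ᵐ x ∂(νmix (S ∆ {i, i + 1})), κ x {z | pinnedStat i z = pinnedStat i x} = 1) ∧
  ∀ (A : Set Obs), MeasurableSet A → ∀ (B : Set (Obs × Set (Site 2 × Site 2))), MeasurableSet B →
    νmix (S ∆ {i, i + 1}) (A ∩ pinnedStat i ⁻¹' B) =
      ∫⁻ x in pinnedStat i ⁻¹' B, κ x A ∂(νmix (S ∆ {i, i + 1}))

/-- Total variation distance on the events determined by the cells/faces of the window `W`. [folklore] -/
def tvOn (W : Set (Site 2)) (μ ν : Measure Obs) : ℝ≥0∞ :=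
  ⨆ (E : Set Obs) (_ : E ∈ determinedOn W) (_ : MeasurableSet E), max (μ E - ν E) (ν E - μ E)

/-- (A) STRONG SPATIAL MIXING IN MEAN of the diagram-conditioned middle data, with constants `C, c`: for
every cell `v` and radius `r` some law `κloc x`, reading `x` on `ballInf v (2r)` only, is, on average
over the environment `x ∼ νmix S`, within `C e^{-cr}` of every pinned conditional law `κ x` on the events
of `ballInf v r`. [folklore] -/
def MeanSSM (C c : ℝ) (S : Set ℤ) (i : ℤ) : Prop :=
  ∀ κ : Obs → Measure Obs, IsPinnedCondLaw S i κ → ∀ (v : Site 2) (r : ℕ), ∃ κloc : Obs → Measure Obs,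
    (∀ x x' : Obs, (∀ w ∈ ballInf v (2 * r), (w ∈ x.1 ↔ w ∈ x'.1) ∧ (w ∈ x.2 ↔ w ∈ x'.2)) →
      κloc x = κloc x') ∧
    ∫⁻ x, tvOn (ballInf v r) (κ x) (κloc x) ∂(νmix S) ≤ ENNReal.ofReal (C * Real.exp (-c * r))

/-- The pinned conditional law exists (instance of the landed `ps_exists_pinnedCondLaw`-type
disintegration is not needed here; recorded: `IsPinnedCondLaw` only repackages its conclusion through
`pinnedStat`). Fibres of `pinnedStat` are the joint fibres of `eraseMid` and `stripDiagram`. [folklore] -/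
theorem pinnedStat_eq_iff (i : ℤ) (x z : Obs) :
    pinnedStat i z = pinnedStat i x ↔ eraseMid i z = eraseMid i x ∧ stripDiagram i z = stripDiagram i x :=
  Prod.mk.injEq _ _ _ _ |>.to_iff

/-- Sup-balls are monotone in the radius. [folklore] -/
theorem ballInf_mono (v : Site 2) {r r' : ℕ} (h : r ≤ r') : ballInf v r ⊆ ballInf v r' := by
  intro w hw
  simp only [ballInf, mem_setOf_eq] at hw ⊢
  exact ⟨hw.1.trans (by exact_mod_cast h), hw.2.trans (by exact_mod_cast h)⟩

/-- When `StripDiagramExchange S i` fails, the IDENTITY is a pinned sampler (clause 5 is vacuous), for any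
constants. [folklore] -/
theorem pinnedSampler_id_of_not (C c : ℝ) (S : Set ℤ) (i : ℤ) (h : ¬ StripDiagramExchange S i) :
    PinnedSampler C c S i (fun x _ => x) := by
  refine ⟨measurable_fst, fun _ _ => rfl, fun _ _ => rfl, fun _ _ _ => rfl, fun h' => absurd h' h,
    fun v r => ⟨fun x _ => x, fun x x' u u' hagree w hw => ?_, ?_⟩⟩
  · have hw' : w ∈ ballInf v (2 * r) := ballInf_mono v (by omega) hw
    exact ⟨(hagree w hw').1, (hagree w hw').2.1⟩
  · have : {xu : Obs × Rnd | ∃ w ∈ ballInf v r, ¬((w ∈ xu.1.1 ↔ w ∈ xu.1.1) ∧ (w ∈ xu.1.2 ↔ w ∈ xu.1.2))} =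
        ∅ := by
      ext xu; simp
    rw [this, measure_empty]
    exact zero_le

/-- COMPOSITION (sorry-free; registered sub-goal): (A) strong spatial mixing in mean with constants uniform
in the admissible `(S, i)`, and (B) the coding step "mean SSM + strip diagram exchange ⇒ pinned sampler,
with constants depending on the mixing constants only", give the registered signature of
`stub_PinnedSampler` verbatim. [folklore] -/
theorem pinnedSampler_of_meanSSM_of_coding :
    (∃ C c : ℝ, 0 < c ∧ ∀ (S : Set ℤ) (i : ℤ), (i ∈ S ↔ i + 1 ∉ S) → MeanSSM C c S i) →
    (∀ C c : ℝ, 0 < c → ∃ C' c' : ℝ, 0 < c' ∧ ∀ (S : Set ℤ) (i : ℤ), (i ∈ S ↔ i + 1 ∉ S) →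
      StripDiagramExchange S i → MeanSSM C c S i → ∃ G : Obs → Rnd → Obs, PinnedSampler C' c' S i G) →
    ∃ C c : ℝ, 0 < c ∧ ∀ (S : Set ℤ) (i : ℤ), (i ∈ S ↔ i + 1 ∉ S) →
      ∃ G : Obs → Rnd → Obs, PinnedSampler C c S i G := by
  rintro ⟨C, c, hc, hssm⟩ hB
  obtain ⟨C', c', hc', hcod⟩ := hB C c hc
  refine ⟨C', c', hc', fun S i hSi => ?_⟩
  by_cases hX : StripDiagramExchange S i
  · exact hcod S i hSi hX (hssm S i hSi)
  · exact ⟨fun x _ => x, pinnedSampler_id_of_not C' c' S i hX⟩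

end Summit.CriticalPhenomena.CardyFormulaZ2.Theorems.IKLinearTransport.PinnedDiagramExchange
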